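import Summits.CriticalPhenomena.PercolationContinuityZ3.Theorems.Transplant.HexShadowGammaMin
import HarnessLib

/-!
# HEXAGONAL SHADOWS XVIII — the objects of DST §2.3 in hexagonal geometry: the data and range of the Gluing Lemma, the event `𝒳`, the minimal path
# `γ_min`, its columns, the set `U(ω)`; FACTS 1 and 2 as nodes and **the Gluing Lemma `HexGluing` from the two facts**

builds on p205010 (kernel theorem, internal audit signed; external expert review pending) — NOT used in this file.
Lane `prim-bschramm`, seat `prim-bschramm-p2` (gen 32; class C1b; memo `HOME/bschramm/P2-LATTICES.md` §116–§117); helper file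
(`--supports stmt-CriticalPhenomena-4575 --as helper`).  Slab original: `Literature/…/SlabGluing` §"GlueEvents"/"Facts" (`GlueGeom`, `evX`, `γmin`, `γcols`, `U`,
`…_fact1`, `…_fact2`, `…_lemma6_of_facts`).
* §1 `GlueData = (m, u₃, u₁, a, s)` and its range `GlueData.InRange Φ` (that of `HexGluing`: `period ∣ m`, `2u₃ ≤ 3m`, `2u₁ ≤ m`, `1 ≤ a ≤ m − 1`,
  `period·s ∈ [−3m, m]`); the shadow sets `big = hexBall c 6m` (`B_{3n}`), `small = hexBall c' 2m` (`B'_n`), `src`, `src'`, `zSeg`, and the event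
  `evX = A ∩ B⁻ ∩ B⁺ ∩ Cᶜ` (the events `A, B∓, C` are «HexShadowGluing»'s `glueA`, `glueBm`, `glueBp`, `glueC`);
* §2 `γmin D ω` (the minimal open self-avoiding path from `\overline{src}` to `\overline{zSeg}` inside `\overline{big}`, «HexShadowGammaMin»), its columns
  `γcols ⊆ 𝕋`, **the set `U(ω)`** (points `z` of `small` on a column of `γ_min` such that some vertex over the unit hexagon `hexBall z 1` is joined to `\overline{src'}`
  inside `\overline{small}` OFF the columns of `γ_min` — DST's (P1)–(P2)), finiteness;
* §3 the nodes **`HexFact1`** (`∀ t ∃ L ∀ data: P[𝒳 ∩ {|U| < t}] ≤ L · P[(B⁻ ∩ B⁺)ᶜ]`, the constant uniform in the data — what Lemma 7 applied to the closing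
  map gives) and **`HexFact2`** (`∀ ε ∃ t ∃ m₀ ∀ data with m ≥ m₀: P[𝒳 ∩ {|U| ≥ t}] ≤ ε · P[C]` — the local surgery), internal obligations never asserted, and
  **`hexGluing_of_facts : HexFact1 → HexFact2 → HexGluing`** PROVED ("choosing first `t` as in Fact 2 and then `δ` as in Fact 1").
[cite: DuminilCopinSidoraviciusTassion2016, Lemma 6 and §2.3 (𝒳, γ_min, U(ω), Facts 1–2, p. 7)]
-/

noncomputable section

namespace Summit.CriticalPhenomena.PercolationContinuityZ3.Theorems.Transplant

open MeasureTheory Literature.Probability.Percolation Literature.Probability.LatticeModels SimpleGraph Filter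
open scoped Classical Topology

/-! ## §1 The data, the sets and the event `𝒳` -/

/-- **The data of the hexagonal Gluing Lemma**: the scale `m`, the inner radii `u₃` (of `S₃ = hexBall c u₃`) and `u₁` (of `S' = hexBall c' u₁`), the
landing half-width `a`, and the side offset `s` (`c' = c + (4m, period·s)`). [cite: DuminilCopinSidoraviciusTassion2016, §2.1 (p. 5: n, u_{3n}, u_n, α_n, y)] -/
structure GlueData where
  /-- the scale (hexagons of radius `2m`, `6m`) -/
  m : ℕ
  /-- the radius of `S₃` -/
  u₃ : ℕ
  /-- the radius of `S'` -/
  u₁ : ℕ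
  /-- the half-width of the landing zone -/
  a : ℕ
  /-- the side offset, in units of the period -/
  s : ℤ

namespace HexShadow

variable {V : Type} {G : SimpleGraph V} (Φ : HexShadow G)

/-- **The range of the data** (that of `HexGluing`): `period ∣ m`, `2u₃ ≤ 3m` (no touching), `2u₁ ≤ m`, `1 ≤ a ≤ m − 1`, `period·s ∈ [−3m, m]`.  A predicate on
the data, the standing hypothesis of Facts 1–2. [cite: DuminilCopinSidoraviciusTassion2016, Lemma 6] -/
def InRange (D : GlueData) : Prop :=
  Φ.period ∣ D.m ∧ 2 * D.u₃ ≤ 3 * D.m ∧ 2 * D.u₁ ≤ D.m ∧ 1 ≤ D.a ∧ D.a + 1 ≤ D.m ∧ -(3 * (D.m : ℤ)) ≤ Φ.period * D.s ∧ (Φ.period : ℤ) * D.s ≤ D.m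

/-- `H₃ = hexBall c 6m` (DST's `B_{3n}`). [cite: DuminilCopinSidoraviciusTassion2016, §2.1 (p. 5)] -/
def big (D : GlueData) : Set (Site 2) := hexBall Φ.centre (6 * D.m)

/-- `B' = hexBall c' 2m` (DST's `B'_n`). [cite: DuminilCopinSidoraviciusTassion2016, §2.1 (p. 5)] -/
def small (D : GlueData) : Set (Site 2) := hexBall (Φ.glueCentre D.m D.s) (2 * D.m)

/-- `S₃ = hexBall c u₃` (DST's `S_{3n}`). [cite: DuminilCopinSidoraviciusTassion2016, §2.1 (p. 5)] -/
def src (D : GlueData) : Set (Site 2) := hexBall Φ.centre D.u₃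

/-- `S' = hexBall c' u₁` (DST's `S'_n`). [cite: DuminilCopinSidoraviciusTassion2016, §2.1 (p. 5)] -/
def src' (D : GlueData) : Set (Site 2) := hexBall (Φ.glueCentre D.m D.s) D.u₁

/-- `Z = hexSide c' m (−a) a` (DST's `Z_n`). [cite: DuminilCopinSidoraviciusTassion2016, §2.1 (p. 5)] -/
def zSeg (D : GlueData) : Set (Site 2) := hexSide (Φ.glueCentre D.m D.s) D.m (-(D.a : ℤ)) D.a

/-- **`𝒳 = A ∩ B⁻ ∩ B⁺ ∩ Cᶜ`** (DST §2.3, p. 6). [cite: DuminilCopinSidoraviciusTassion2016, §2.3 (p. 6, the event 𝒳)] -/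
def evX (D : GlueData) : Set (BondConfig V) :=
  Φ.glueA D.m D.u₃ D.a D.s ∩ Φ.glueBm D.m D.u₁ D.a D.s ∩ Φ.glueBp D.m D.u₁ D.a D.s ∩ (Φ.glueC D.m D.u₃ D.u₁ D.s)ᶜ

/-- `A` is the crossing `src ⟷^{big} zSeg`. [folklore] -/
theorem glueA_eq (D : GlueData) : Φ.glueA D.m D.u₃ D.a D.s = Φ.conn (Φ.big D) (Φ.src D) (Φ.zSeg D) := rfl

/-- `C` is the crossing `src ⟷^{big ∪ small} src'`. [folklore] -/
theorem glueC_eq (D : GlueData) : Φ.glueC D.m D.u₃ D.u₁ D.s = Φ.conn (Φ.big D ∪ Φ.small D) (Φ.src D) (Φ.src' D) := rfl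

/-- `\overline{big}` is finite. [folklore] -/
theorem lift_big_finite (D : GlueData) : (Φ.lift (Φ.big D)).Finite := Φ.lift_finite (hexBall_finite _ _)

/-- `\overline{big ∪ small}` is finite. [folklore] -/
theorem lift_window_finite (D : GlueData) : (Φ.lift (Φ.big D ∪ Φ.small D)).Finite :=
  Φ.lift_finite ((hexBall_finite _ _).union (hexBall_finite _ _))

/-! ## §2 The minimal path, its columns, the set `U(ω)` -/

variable [Countable V]

/-- **`γ_min(ω)`**: the minimal open self-avoiding path from `\overline{src}` to `\overline{zSeg}` inside `\overline{big}`.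
[cite: DuminilCopinSidoraviciusTassion2016, §2.3 (Definition of γ_min)] -/
def γmin (D : GlueData) (ω : BondConfig V) : List V := minSAP ω (Φ.lift (Φ.big D)) (Φ.lift (Φ.src D)) (Φ.lift (Φ.zSeg D))

/-- The columns of `γ_min(ω)`: its shadow in `𝕋`. [cite: DuminilCopinSidoraviciusTassion2016, §2.3 (P1, P2)] -/
def γcols (D : GlueData) (ω : BondConfig V) : Set (Site 2) := {z | ∃ x ∈ Φ.γmin D ω, Φ.sh x = z}

/-- **The set `U(ω)`** (DST §2.3, Definition, p. 6): the points `z` of `small` such that (P1) the column of `z` meets `γ_min(ω)` and (P2) some vertex over the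
unit hexagon `hexBall z 1` is joined to `\overline{src'}` by an open path inside `\overline{small}` all of whose vertices lie OFF the columns of `γ_min(ω)`
(so that the shadow of the path is at `triNorm`-distance exactly `1` from that of `γ_min`). [cite: DuminilCopinSidoraviciusTassion2016, §2.3 (Definition of U(ω), p. 6)] -/
def U (D : GlueData) (ω : BondConfig V) : Set (Site 2) :=
  {z | z ∈ Φ.small D ∧ z ∈ Φ.γcols D ω ∧
    ∃ x₀ : V, Φ.sh x₀ ∈ hexBall z 1 ∧ ∃ s' ∈ Φ.lift (Φ.src' D), ω ∈ openConnIn (Φ.lift (Φ.small D) ∩ {v | Φ.sh v ∉ Φ.γcols D ω}) x₀ s'}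

/-- `U(ω)` lies in the columns of `γ_min(ω)`. [folklore] -/
theorem U_subset_γcols (D : GlueData) (ω : BondConfig V) : Φ.U D ω ⊆ Φ.γcols D ω := fun _ h => h.2.1

/-- The columns of `γ_min` form a finite set. [folklore] -/
theorem γcols_finite (D : GlueData) (ω : BondConfig V) : (Φ.γcols D ω).Finite := by
  have : Φ.γcols D ω = Φ.sh '' {x | x ∈ Φ.γmin D ω} := by ext z; simp [γcols]
  rw [this]
  exact (List.finite_toSet _).image _

/-- `U(ω)` is finite. [folklore] -/
theorem U_finite (D : GlueData) (ω : BondConfig V) : (Φ.U D ω).Finite := (Φ.γcols_finite D ω).subset (Φ.U_subset_γcols D ω)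

/-- On `A`, `γ_min` is an open self-avoiding path from `\overline{src}` to `\overline{zSeg}` inside `\overline{big}`, of least key.
[cite: DuminilCopinSidoraviciusTassion2016, §2.3 (Definition of γ_min)] -/
theorem γmin_spec (D : GlueData) {ω : BondConfig V} (hA : ω ∈ Φ.glueA D.m D.u₃ D.a D.s) :
    OpenSAP ω (Φ.lift (Φ.big D)) (Φ.lift (Φ.src D)) (Φ.lift (Φ.zSeg D)) (Φ.γmin D ω) ∧
      ∀ l, OpenSAP ω (Φ.lift (Φ.big D)) (Φ.lift (Φ.src D)) (Φ.lift (Φ.zSeg D)) l → sapKey (Φ.γmin D ω) ≤ sapKey l :=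
  minSAP_spec (Φ.lift_big_finite D) ((mem_openCrossing_iff_exists_openSAP ω _ _ _).1 hA)

/-- Configurations agreeing on the pairs over the window `big ∪ small` have the same `γ_min`. [folklore] -/
theorem γmin_congr (D : GlueData) {ω ω' : BondConfig V} (h : ∀ e ∈ (Φ.lift (Φ.big D ∪ Φ.small D)).sym2, e ∈ ω ↔ e ∈ ω') :
    Φ.γmin D ω = Φ.γmin D ω' :=
  minSAP_congr (Φ.lift_big_finite D) fun e he => h e (by
    rw [Set.mem_sym2_iff_subset] at he ⊢; exact he.trans (Φ.lift_mono Set.subset_union_left))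

/-- Configurations agreeing on the pairs over the window have the same `U`. [folklore] -/
theorem U_congr (D : GlueData) {ω ω' : BondConfig V} (h : ∀ e ∈ (Φ.lift (Φ.big D ∪ Φ.small D)).sym2, e ∈ ω ↔ e ∈ ω') : Φ.U D ω = Φ.U D ω' := by
  have hcols : Φ.γcols D ω = Φ.γcols D ω' := by simp only [γcols, Φ.γmin_congr D h]
  ext z
  simp only [U, Set.mem_setOf_eq, hcols]
  refine and_congr_right fun _ => and_congr_right fun _ => ?_
  refine exists_congr fun x₀ => and_congr_right fun _ => exists_congr fun s' => and_congr_right fun _ => ?_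
  exact openConnIn_congr (fun e he => h e (by
    rw [Set.mem_sym2_iff_subset] at he ⊢
    exact he.trans (Set.inter_subset_left.trans (Φ.lift_mono Set.subset_union_right)))) x₀ s'

omit [Countable V] in
/-- The crossings `X ⟷^B Y` with `B ⊆ big ∪ small` only depend on the window. [folklore] -/
theorem mem_conn_congr (D : GlueData) {ω ω' : BondConfig V} (h : ∀ e ∈ (Φ.lift (Φ.big D ∪ Φ.small D)).sym2, e ∈ ω ↔ e ∈ ω') {B : Set (Site 2)}
    (hB : B ⊆ Φ.big D ∪ Φ.small D) (X Y : Set (Site 2)) : ω ∈ Φ.conn B X Y ↔ ω' ∈ Φ.conn B X Y := by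
  have hd := Φ.determinedBy_conn X Y hB
  rw [determinedBy_iff] at hd
  exact hd ω ω' (Set.ext fun e => ⟨fun he => ⟨(h e he.2).1 he.1, he.2⟩, fun he => ⟨(h e he.2).2 he.1, he.2⟩⟩)

omit [Countable V] in
/-- `𝒳` only depends on the window. [folklore] -/
theorem mem_evX_congr (D : GlueData) {ω ω' : BondConfig V} (h : ∀ e ∈ (Φ.lift (Φ.big D ∪ Φ.small D)).sym2, e ∈ ω ↔ e ∈ ω') :
    ω ∈ Φ.evX D ↔ ω' ∈ Φ.evX D := by
  have hA : ω ∈ Φ.glueA D.m D.u₃ D.a D.s ↔ ω' ∈ Φ.glueA D.m D.u₃ D.a D.s :=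
    Φ.mem_conn_congr D h (B := Φ.big D) Set.subset_union_left (Φ.src D) (Φ.zSeg D)
  have hBm : ω ∈ Φ.glueBm D.m D.u₁ D.a D.s ↔ ω' ∈ Φ.glueBm D.m D.u₁ D.a D.s :=
    Φ.mem_conn_congr D h (B := Φ.small D) Set.subset_union_right (Φ.src' D) (hexSide (Φ.glueCentre D.m D.s) D.m (-(D.m : ℤ)) (-(D.a : ℤ)))
  have hBp : ω ∈ Φ.glueBp D.m D.u₁ D.a D.s ↔ ω' ∈ Φ.glueBp D.m D.u₁ D.a D.s :=
    Φ.mem_conn_congr D h (B := Φ.small D) Set.subset_union_right (Φ.src' D) (hexSide (Φ.glueCentre D.m D.s) D.m D.a D.m)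
  have hC : ω ∈ Φ.glueC D.m D.u₃ D.u₁ D.s ↔ ω' ∈ Φ.glueC D.m D.u₃ D.u₁ D.s :=
    Φ.mem_conn_congr D h (B := Φ.big D ∪ Φ.small D) subset_rfl (Φ.src D) (Φ.src' D)
  simp only [evX, Set.mem_inter_iff, Set.mem_compl_iff, hA, hBm, hBp, hC]

/-! ## §3 Facts 1 and 2 as nodes; the Gluing Lemma from them -/

/-- **NODE — DST §2.3, FACT 1, in hexagonal geometry** (the form its proof gives, with an unspecified constant): for `0 < p < 1` and every `t` there is `L`
(depending on `t`, `p`, the graph, NOT on the data) with `P_p[𝒳 ∩ {|U| < t}] ≤ L · P_p[(B⁻ ∩ B⁺)ᶜ]` for all data in range.  (Lemma 7 applied to the map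
closing the edges at the columns of `U(ω)` whose other endpoint is joined to `\overline{src'}`; the planar crossing fact for `𝕋`-walks.)  Internal obligation,
never asserted. [cite: DuminilCopinSidoraviciusTassion2016, §2.3 (Fact 1, p. 6)] -/
def HexFact1 {V : Type} {G : SimpleGraph V} (Φ : HexShadow G) [Countable V] : Prop :=
  ∀ p : unitInterval, 0 < (p : ℝ) → (p : ℝ) < 1 → ∀ t : ℕ, ∃ L : ℝ, ∀ D : GlueData, Φ.InRange D →
    (bondPercolation G p).real (Φ.evX D ∩ {ω | (Φ.U D ω).ncard < t}) ≤ L * (bondPercolation G p).real (Φ.glueBm D.m D.u₁ D.a D.s ∩ Φ.glueBp D.m D.u₁ D.a D.s)ᶜ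

/-- **NODE — DST §2.3, FACT 2, in hexagonal geometry**: for `0 < p < 1` and every `ε > 0` there are `t` and a scale `m₀` such that
`P_p[𝒳 ∩ {|U| ≥ t}] ≤ ε · P_p[C]` for all data in range with `m ≥ m₀` (Lemma 7 applied to the local surgeries `ω ↦ {ω^{(z)} : z ∈ U(ω)}`; needs three
disjoint paths in a column block of the instance).  Internal obligation, never asserted. [cite: DuminilCopinSidoraviciusTassion2016, §2.3 (Fact 2, pp. 6–7)] -/
def HexFact2 {V : Type} {G : SimpleGraph V} (Φ : HexShadow G) [Countable V] : Prop :=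
  ∀ p : unitInterval, 0 < (p : ℝ) → (p : ℝ) < 1 → ∀ ε : ℝ, 0 < ε → ∃ t : ℕ, ∃ m₀ : ℕ, ∀ D : GlueData, m₀ ≤ D.m → Φ.InRange D →
    (bondPercolation G p).real (Φ.evX D ∩ {ω | t ≤ (Φ.U D ω).ncard}) ≤ ε * (bondPercolation G p).real (Φ.glueC D.m D.u₃ D.u₁ D.s)

/-- `𝒳` splits along `|U| < t` / `|U| ≥ t`. [folklore] -/
theorem real_evX_le (D : GlueData) (p : unitInterval) (t : ℕ) :
    (bondPercolation G p).real (Φ.evX D) ≤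
      (bondPercolation G p).real (Φ.evX D ∩ {ω | (Φ.U D ω).ncard < t}) + (bondPercolation G p).real (Φ.evX D ∩ {ω | t ≤ (Φ.U D ω).ncard}) := by
  have : Φ.evX D ⊆ (Φ.evX D ∩ {ω | (Φ.U D ω).ncard < t}) ∪ (Φ.evX D ∩ {ω | t ≤ (Φ.U D ω).ncard}) := by
    intro ω hω
    by_cases h : (Φ.U D ω).ncard < t
    · exact Or.inl ⟨hω, h⟩
    · exact Or.inr ⟨hω, not_lt.1 h⟩
  exact (measureReal_mono this).trans (measureReal_union_le _ _)

omit [Countable V] in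
/-- `{A, B⁻, B⁺} ⊆ C ∪ 𝒳`. [folklore] -/
theorem real_triple_le (D : GlueData) (p : unitInterval) :
    (bondPercolation G p).real (Φ.glueA D.m D.u₃ D.a D.s ∩ Φ.glueBm D.m D.u₁ D.a D.s ∩ Φ.glueBp D.m D.u₁ D.a D.s) ≤
      (bondPercolation G p).real (Φ.glueC D.m D.u₃ D.u₁ D.s) + (bondPercolation G p).real (Φ.evX D) := by
  have : Φ.glueA D.m D.u₃ D.a D.s ∩ Φ.glueBm D.m D.u₁ D.a D.s ∩ Φ.glueBp D.m D.u₁ D.a D.s ⊆ Φ.glueC D.m D.u₃ D.u₁ D.s ∪ Φ.evX D := by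
    intro ω hω
    by_cases hC : ω ∈ Φ.glueC D.m D.u₃ D.u₁ D.s
    · exact Or.inl hC
    · exact Or.inr ⟨hω, hC⟩
  exact (measureReal_mono this).trans (measureReal_union_le _ _)

omit [Countable V] in
/-- `B⁻ ∩ B⁺` is measurable. [folklore] -/
theorem measurableSet_glueB (D : GlueData) : MeasurableSet (Φ.glueBm D.m D.u₁ D.a D.s ∩ Φ.glueBp D.m D.u₁ D.a D.s) :=
  (Φ.measurableSet_sideEvent _ _ _ _ _).inter (Φ.measurableSet_sideEvent _ _ _ _ _)

/-- A density with `θ_v(p) > 0` is positive. [folklore] -/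
private theorem coe_pos_of_theta_pos₁₈ {v : V} {p : unitInterval} (h : 0 < theta G v p) : 0 < (p : ℝ) := by
  rcases eq_or_lt_of_le p.2.1 with h0 | h0
  · exfalso
    have hp : p = 0 := Subtype.ext h0.symm
    rw [hp, theta_bot] at h
    exact lt_irrefl _ h
  · exact h0

/-- **THE GLUING LEMMA FROM FACTS 1 AND 2** ("Fix `ε > 0`. Choosing first `t` as in Fact 2 and then `δ` as in Fact 1 conclude the proof of Lemma 6",
DST §2.3, p. 7): given `ε`, take `t, m₀` as in Fact 2 for `ε/2`, `L` as in Fact 1 for `t`, and `δ (1 + L) = ε/2`; then `P[𝒳] ≤ Lδ + (ε/2) P[C]` and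
`P[C] ≥ P[A ∩ B⁻ ∩ B⁺] − P[𝒳] ≥ 1 − ε`. [cite: DuminilCopinSidoraviciusTassion2016, §2.3 (p. 7, conclusion of the proof of Lemma 6)] -/
theorem hexGluing_of_facts (h1 : Φ.HexFact1) (h2 : Φ.HexFact2) : Φ.HexGluing := by
  intro v p hθ hp1 ε hε
  have hp0 : 0 < (p : ℝ) := coe_pos_of_theta_pos₁₈ hθ
  obtain ⟨t, m₀, ht⟩ := h2 p hp0 hp1 (ε / 2) (half_pos hε)
  obtain ⟨L₀, hL₀⟩ := h1 p hp0 hp1 t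
  set L : ℝ := max L₀ 1 with hL
  have hL1 : 1 ≤ L := le_max_right _ _
  refine ⟨ε / (2 * (1 + L)), by positivity, m₀, fun m u₃ u₁ a s hm₀ hdvd hu₃ hu₁ ha1 ham hs1 hs2 hP => ?_⟩
  set D : GlueData := ⟨m, u₃, u₁, a, s⟩ with hD
  have hrange : Φ.InRange D := ⟨hdvd, hu₃, hu₁, ha1, ham, hs1, hs2⟩
  set P := bondPercolation G p with hPdef
  have hF1 : P.real (Φ.evX D ∩ {ω | (Φ.U D ω).ncard < t}) ≤ L * P.real (Φ.glueBm m u₁ a s ∩ Φ.glueBp m u₁ a s)ᶜ :=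
    (hL₀ D hrange).trans (mul_le_mul_of_nonneg_right (le_max_left _ _) measureReal_nonneg)
  have hF2 : P.real (Φ.evX D ∩ {ω | t ≤ (Φ.U D ω).ncard}) ≤ ε / 2 * P.real (Φ.glueC m u₃ u₁ s) := ht D hm₀ hrange
  have hX := Φ.real_evX_le D p t
  have hT := Φ.real_triple_le D p
  have hB : P.real (Φ.glueBm m u₁ a s ∩ Φ.glueBp m u₁ a s)ᶜ ≤ ε / (2 * (1 + L)) := by
    rw [measureReal_compl (Φ.measurableSet_glueB D), probReal_univ]
    have : P.real (Φ.glueA m u₃ a s ∩ Φ.glueBm m u₁ a s ∩ Φ.glueBp m u₁ a s) ≤ P.real (Φ.glueBm m u₁ a s ∩ Φ.glueBp m u₁ a s) :=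
      measureReal_mono (by rw [Set.inter_assoc]; exact Set.inter_subset_right)
    change 1 - P.real (Φ.glueBm m u₁ a s ∩ Φ.glueBp m u₁ a s) ≤ ε / (2 * (1 + L))
    linarith
  have hC1 : P.real (Φ.glueC m u₃ u₁ s) ≤ 1 := measureReal_le_one
  have hC0 : 0 ≤ P.real (Φ.glueC m u₃ u₁ s) := measureReal_nonneg
  have hεC : ε / 2 * P.real (Φ.glueC m u₃ u₁ s) ≤ ε / 2 := by
    have := mul_le_mul_of_nonneg_left hC1 (half_pos hε).le
    simpa using this
  have hLB : L * P.real (Φ.glueBm m u₁ a s ∩ Φ.glueBp m u₁ a s)ᶜ ≤ L * (ε / (2 * (1 + L))) := mul_le_mul_of_nonneg_left hB (by positivity)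
  have hsum : L * (ε / (2 * (1 + L))) + ε / (2 * (1 + L)) = ε / 2 := by
    field_simp
    ring
  have hXD : P.real (Φ.evX D) = P.real (Φ.evX ⟨m, u₃, u₁, a, s⟩) := rfl
  nlinarith [hP, hF1, hF2, hX, hT, hB, hLB, hsum, hεC]

end HexShadow

end Summit.CriticalPhenomena.PercolationContinuityZ3.Theorems.Transplant

end
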